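import Summits.Ventures.PercRepro.Night2LocalD2R14SixZeroM

/-!
# PercRepro — THE (6,4) SHADOW ROW FOR EVERY FINITE MATROID (night-2, gen 16)

The last cell: at `|G ∖ S| = 3` at most five pair preimages have `|G ∖ cl B| = 3` (`card_three_le_five_of_three`):
six would force each of the three points of `G ∖ S` into exactly four pair closures (each lies in at most four and the
traces of the six rich preimages count `12`), hence onto a line with its own pair `Pᵢ` (Night2LocalD2R14SixZeroM), the
pairs being distinct; the rich preimages are counted by the two points of `G ∖ S` they contain — at most `2` per pair
of points and at most `1` unless the two pairs are disjoint — and three pairwise disjoint pairs do not fit in five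
points.  With it the cell `κ = 0` closes (`sum_r14W_col_le_of_card_six_of_noColoop'`) and

**`shadowHall_six_four`**: `ShadowHall M 6 4 (phiK 6 4)` for every finite matroid `M` — the `(6, 4)` shadow row, hence
(`c025_of_shadowHall`) the body of C-025 at `(6, 4)`.
-/

namespace PercRepro.Shadow

open Finset PerFlat ThmH

variable {α : Type*} [DecidableEq α] {M : Matroid α} [M.Finite]

open scoped Classical in
/-- **At `|G ∖ S| = 3` at most five pair preimages have `|G ∖ cl B| = 3`** (`|S| = 6`, simple matroid). -/
theorem card_three_le_five_of_three {G : Finset α} (hG : G ∈ flatsQ M (4 + 1))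
    (hsimple : ∀ e ∈ gr M, ∀ f ∈ gr M, e ≠ f → rkN M {e, f} = 2) {y : α} (hyG : y ∈ G)
    (hyc : y ∉ clF M (G.erase y)) {S : Finset α} (hS : S ∈ shadowAt M (4 + 2) 4 (Uq M (4 + 2) 4) G)
    (h6 : S.card = 6) (hq3 : (G \ S).card = 3) :
    ((pairPre M 4 G S).filter (fun B => (G \ clF M B).card = 3)).card ≤ 5 := by
  have hyS : y ∈ S := mem_of_mem_shadowAt_of_coloop (by rw [rkN_erase_eq_of_coloop hG hyG hyc]) hS
  set R := (pairPre M 4 G S).filter (fun B => (G \ clF M B).card = 3) with hRdef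
  by_contra hcon
  push Not at hcon
  -- (1) the traces: `Σ_g #{B : g ∈ cl B} = Σ_B |(G ∖ S) ∩ cl B| ≥ 2 · |R| ≥ 12`
  have hdc := Finset.sum_card_bipartiteAbove_eq_sum_card_bipartiteBelow (fun g B => g ∈ clF M B) (s := G \ S)
    (t := pairPre M 4 G S)
  have hR2 : ∀ B ∈ R, (Finset.bipartiteBelow (fun g B => g ∈ clF M B) (G \ S) B).card = 2 := by
    intro B hB
    rw [hRdef, Finset.mem_filter] at hB
    have heq : Finset.bipartiteBelow (fun g B => g ∈ clF M B) (G \ S) B = (G \ S) ∩ clF M B := by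
      ext e
      rw [Finset.mem_bipartiteBelow, Finset.mem_inter]
    rw [heq]
    have := card_inter_clF_of_three hS hB.1 hB.2
    omega
  have hsum12 : 12 ≤ ∑ B ∈ pairPre M 4 G S, (Finset.bipartiteBelow (fun g B => g ∈ clF M B) (G \ S) B).card := by
    have hsub := Finset.sum_le_sum_of_subset_of_nonneg
      (f := fun B => (Finset.bipartiteBelow (fun g B => g ∈ clF M B) (G \ S) B).card)
      (Finset.filter_subset (fun B => (G \ clF M B).card = 3) (pairPre M 4 G S)) (fun _ _ _ => Nat.zero_le _)
    rw [← hRdef, Finset.sum_congr rfl hR2, Finset.sum_const, smul_eq_mul] at hsub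
    omega
  -- (2) each point lies in at most four closures, so in exactly four
  obtain ⟨g₁, g₂, g₃, h12, h13, h23, hGS⟩ := Finset.card_eq_three.1 hq3
  have hg₁ : g₁ ∈ G \ S := by rw [hGS]; simp
  have hg₂ : g₂ ∈ G \ S := by rw [hGS]; simp
  have hg₃ : g₃ ∈ G \ S := by rw [hGS]; simp
  have hf : ∀ g ∈ G \ S, (Finset.bipartiteAbove (fun g B => g ∈ clF M B) (pairPre M 4 G S) g).card ≤ 4 :=
    fun g hg => card_pairPre_filter_mem_clF_le_four hG hsimple hyG hyc hS h6 hg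
  have hsumL : ∑ g ∈ G \ S, (Finset.bipartiteAbove (fun g B => g ∈ clF M B) (pairPre M 4 G S) g).card =
      (Finset.bipartiteAbove (fun g B => g ∈ clF M B) (pairPre M 4 G S) g₁).card +
      (Finset.bipartiteAbove (fun g B => g ∈ clF M B) (pairPre M 4 G S) g₂).card +
      (Finset.bipartiteAbove (fun g B => g ∈ clF M B) (pairPre M 4 G S) g₃).card := by
    rw [hGS, Finset.sum_insert (by simp [h12, h13]), Finset.sum_insert (by simp [h23]), Finset.sum_singleton]
    ring
  have hf₁ := hf g₁ hg₁
  have hf₂ := hf g₂ hg₂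
  have hf₃ := hf g₃ hg₃
  have h4₁ : 4 ≤ ((pairPre M 4 G S).filter (fun B => g₁ ∈ clF M B)).card := by
    show 4 ≤ (Finset.bipartiteAbove (fun g B => g ∈ clF M B) (pairPre M 4 G S) g₁).card
    omega
  have h4₂ : 4 ≤ ((pairPre M 4 G S).filter (fun B => g₂ ∈ clF M B)).card := by
    show 4 ≤ (Finset.bipartiteAbove (fun g B => g ∈ clF M B) (pairPre M 4 G S) g₂).card
    omega
  have h4₃ : 4 ≤ ((pairPre M 4 G S).filter (fun B => g₃ ∈ clF M B)).card := by
    show 4 ≤ (Finset.bipartiteAbove (fun g B => g ∈ clF M B) (pairPre M 4 G S) g₃).card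
    omega
  -- (3) the lines
  obtain ⟨a₁, b₁, ha₁, hb₁, hab₁, hℓ₁, hform₁, B₁, hB₁, hgB₁, hX₁⟩ :=
    exists_pairPre_sdiff_eq_of_four hG hsimple hyG hyc hS h6 hg₁ h4₁
  obtain ⟨a₂, b₂, ha₂, hb₂, hab₂, hℓ₂, hform₂, B₂, hB₂, hgB₂, hX₂⟩ :=
    exists_pairPre_sdiff_eq_of_four hG hsimple hyG hyc hS h6 hg₂ h4₂
  obtain ⟨a₃, b₃, ha₃, hb₃, hab₃, hℓ₃, hform₃, B₃, hB₃, hgB₃, hX₃⟩ :=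
    exists_pairPre_sdiff_eq_of_four hG hsimple hyG hyc hS h6 hg₃ h4₃
  -- (4) the pairs are distinct
  have hPne : ∀ (g g' : α) (a b a' b' : α) (B B' : Finset α), g ∈ G \ S → g' ∈ G \ S → g ≠ g' →
      g ∈ clF M ({a, b} : Finset α) → g' ∈ clF M ({a', b'} : Finset α) → B ∈ pairPre M 4 G S → B' ∈ pairPre M 4 G S →
      g ∈ clF M B → g' ∈ clF M B' → S \ B = {a, b} → S \ B' = {a', b'} → ({a, b} : Finset α) ≠ {a', b'} := by
    intro g g' a b a' b' B B' hg hg' hgg hgℓ hg'ℓ hB hB' hgB hg'B' hX hX' heq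
    have hBB' : B = B' := by
      rw [eq_sdiff_sdiff_of_mem_pairPre hB, eq_sdiff_sdiff_of_mem_pairPre hB', hX, hX', heq]
    subst hBB'
    rw [← heq] at hg'ℓ
    exact line_ne_of_ne hG hsimple hS hg hg' hgg hgℓ hg'ℓ hB hgB hg'B' hX
  have hP12 := hPne g₁ g₂ a₁ b₁ a₂ b₂ B₁ B₂ hg₁ hg₂ h12 hℓ₁ hℓ₂ hB₁ hB₂ hgB₁ hgB₂ hX₁ hX₂
  have hP13 := hPne g₁ g₃ a₁ b₁ a₃ b₃ B₁ B₃ hg₁ hg₃ h13 hℓ₁ hℓ₃ hB₁ hB₃ hgB₁ hgB₃ hX₁ hX₃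
  have hP23 := hPne g₂ g₃ a₂ b₂ a₃ b₃ B₂ B₃ hg₂ hg₃ h23 hℓ₂ hℓ₃ hB₂ hB₃ hgB₂ hgB₃ hX₂ hX₃
  -- (5) the count by pairs of points
  have hPsub : ∀ a b : α, a ∈ S.erase y → b ∈ S.erase y → ({a, b} : Finset α) ⊆ S.erase y := by
    intro a b ha hb e he
    rw [Finset.mem_insert, Finset.mem_singleton] at he
    rcases he with rfl | rfl
    · exact ha
    · exact hb
  have hc12 := card_filter_two_points_le (M := M) (G := G) hyS h6 (hPsub a₁ b₁ ha₁ hb₁) (hPsub a₂ b₂ ha₂ hb₂)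
    (Finset.card_pair hab₁) (Finset.card_pair hab₂) hP12 hform₁ hform₂
  have hc13 := card_filter_two_points_le (M := M) (G := G) hyS h6 (hPsub a₁ b₁ ha₁ hb₁) (hPsub a₃ b₃ ha₃ hb₃)
    (Finset.card_pair hab₁) (Finset.card_pair hab₃) hP13 hform₁ hform₃
  have hc23 := card_filter_two_points_le (M := M) (G := G) hyS h6 (hPsub a₂ b₂ ha₂ hb₂) (hPsub a₃ b₃ ha₃ hb₃)
    (Finset.card_pair hab₂) (Finset.card_pair hab₃) hP23 hform₂ hform₃
  -- every rich preimage contains two of the three points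
  have hcover : R ⊆ (pairPre M 4 G S).filter (fun B => g₁ ∈ clF M B ∧ g₂ ∈ clF M B) ∪
      (pairPre M 4 G S).filter (fun B => g₁ ∈ clF M B ∧ g₃ ∈ clF M B) ∪
      (pairPre M 4 G S).filter (fun B => g₂ ∈ clF M B ∧ g₃ ∈ clF M B) := by
    intro B hB
    have hB' := hB
    rw [hRdef, Finset.mem_filter] at hB'
    have htr := card_inter_clF_of_three hS hB'.1 hB'.2
    rw [hq3] at htr
    -- the trace has two elements among `g₁, g₂, g₃`
    have hsub : (G \ S) ∩ clF M B ⊆ G \ S := Finset.inter_subset_left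
    rw [Finset.mem_union, Finset.mem_union, Finset.mem_filter, Finset.mem_filter, Finset.mem_filter]
    by_cases h1 : g₁ ∈ clF M B
    · by_cases h2 : g₂ ∈ clF M B
      · exact Or.inl (Or.inl ⟨hB'.1, h1, h2⟩)
      · by_cases h3 : g₃ ∈ clF M B
        · exact Or.inl (Or.inr ⟨hB'.1, h1, h3⟩)
        · exfalso
          have : (G \ S) ∩ clF M B ⊆ {g₁} := by
            intro e he
            have heGS := (Finset.mem_inter.1 he).1
            rw [hGS, Finset.mem_insert, Finset.mem_insert, Finset.mem_singleton] at heGS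
            rw [Finset.mem_singleton]
            rcases heGS with rfl | rfl | rfl
            · rfl
            · exact absurd (Finset.mem_inter.1 he).2 h2
            · exact absurd (Finset.mem_inter.1 he).2 h3
          have := Finset.card_le_card this
          rw [Finset.card_singleton] at this
          omega
    · by_cases h2 : g₂ ∈ clF M B
      · by_cases h3 : g₃ ∈ clF M B
        · exact Or.inr ⟨hB'.1, h2, h3⟩
        · exfalso
          have : (G \ S) ∩ clF M B ⊆ {g₂} := by
            intro e he
            have heGS := (Finset.mem_inter.1 he).1
            rw [hGS, Finset.mem_insert, Finset.mem_insert, Finset.mem_singleton] at heGS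
            rw [Finset.mem_singleton]
            rcases heGS with rfl | rfl | rfl
            · exact absurd (Finset.mem_inter.1 he).2 h1
            · rfl
            · exact absurd (Finset.mem_inter.1 he).2 h3
          have := Finset.card_le_card this
          rw [Finset.card_singleton] at this
          omega
      · exfalso
        have : (G \ S) ∩ clF M B ⊆ {g₃} := by
          intro e he
          have heGS := (Finset.mem_inter.1 he).1
          rw [hGS, Finset.mem_insert, Finset.mem_insert, Finset.mem_singleton] at heGS
          rw [Finset.mem_singleton]
          rcases heGS with rfl | rfl | rfl
          · exact absurd (Finset.mem_inter.1 he).2 h1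
          · exact absurd (Finset.mem_inter.1 he).2 h2
          · rfl
        have := Finset.card_le_card this
        rw [Finset.card_singleton] at this
        omega
  have hRle := Finset.card_le_card hcover
  have hu1 := Finset.card_union_le ((pairPre M 4 G S).filter (fun B => g₁ ∈ clF M B ∧ g₂ ∈ clF M B))
    ((pairPre M 4 G S).filter (fun B => g₁ ∈ clF M B ∧ g₃ ∈ clF M B))
  have hu2 := Finset.card_union_le ((pairPre M 4 G S).filter (fun B => g₁ ∈ clF M B ∧ g₂ ∈ clF M B) ∪
    (pairPre M 4 G S).filter (fun B => g₁ ∈ clF M B ∧ g₃ ∈ clF M B))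
    ((pairPre M 4 G S).filter (fun B => g₂ ∈ clF M B ∧ g₃ ∈ clF M B))
  -- not all three pairs are pairwise disjoint
  have hnotall : ¬ (Disjoint ({a₁, b₁} : Finset α) {a₂, b₂} ∧ Disjoint ({a₁, b₁} : Finset α) {a₃, b₃} ∧
      Disjoint ({a₂, b₂} : Finset α) {a₃, b₃}) := by
    rintro ⟨d12, d13, d23⟩
    have hsub : ({a₁, b₁} : Finset α) ∪ {a₂, b₂} ∪ {a₃, b₃} ⊆ S.erase y :=
      Finset.union_subset (Finset.union_subset (hPsub a₁ b₁ ha₁ hb₁) (hPsub a₂ b₂ ha₂ hb₂)) (hPsub a₃ b₃ ha₃ hb₃)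
    have hc := Finset.card_le_card hsub
    rw [Finset.card_union_of_disjoint (Finset.disjoint_union_left.2 ⟨d13, d23⟩), Finset.card_union_of_disjoint d12,
      Finset.card_pair hab₁, Finset.card_pair hab₂, Finset.card_pair hab₃, Finset.card_erase_of_mem hyS, h6] at hc
    omega
  -- conclude
  by_cases d12 : Disjoint ({a₁, b₁} : Finset α) {a₂, b₂} <;>
    by_cases d13 : Disjoint ({a₁, b₁} : Finset α) {a₃, b₃} <;>
    by_cases d23 : Disjoint ({a₂, b₂} : Finset α) {a₃, b₃} <;>
    simp only [d12, d13, d23, if_true, if_false] at hc12 hc13 hc23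
  · exact hnotall ⟨d12, d13, d23⟩
  all_goals omega

open scoped Classical in
/-- **The cell `κ = 0` is closed**: the column of R1₄ at a six-element shadow set without a far preimage and without a
coloop of `S` besides `y` is at most `1`. -/
theorem sum_r14W_col_le_of_card_six_of_noColoop' {G : Finset α} (hG : G ∈ flatsQ M (4 + 1))
    (hd : (gr M \ G).card = 2) (hsimple : ∀ e ∈ gr M, ∀ f ∈ gr M, e ≠ f → rkN M {e, f} = 2) {y : α}
    (hyG : y ∈ G) (hyc : y ∉ clF M (G.erase y)) (hP : ∀ z ∈ G.erase y, 4 ≤ rkN M ((G.erase y).erase z))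
    {S : Finset α} (hS : S ∈ shadowAt M (4 + 2) 4 (Uq M (4 + 2) 4) G) (h6 : S.card = 6)
    (hf : opFarPre M G S = ∅) (hno : ∀ z ∈ S, z ≠ y → z ∈ clF M (S.erase z)) :
    ∑ B ∈ membersIn M (Uq M (4 + 2) 4) G, r14W M G B S ≤ 1 :=
  sum_r14W_col_le_of_card_six_of_noColoop hG hd hyG hyc hP hS h6 hf hno (fun _ => by
    rcases Nat.lt_or_ge (G \ S).card 4 with h | h
    · exact card_three_le_five_of_three hG hsimple hyG hyc hS h6 (by omega)
    · exact card_three_le_five_of_four_le hG hsimple hyG hyc hS h6 h)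

open scoped Classical in
/-- **(LI_G) IN CASE A OF THE COLOOP CELL**, unconditionally. -/
theorem localShadowHall_caseA {G : Finset α} (hG : G ∈ flatsQ M (4 + 1)) (hd : (gr M \ G).card = 2)
    (hsimple : ∀ e ∈ gr M, ∀ f ∈ gr M, e ≠ f → rkN M {e, f} = 2) (hk : kColoops M G = 1) {y : α} (hyG : y ∈ G)
    (hyc : y ∉ clF M (G.erase y)) : LocalShadowHall M 4 G := by
  have hP := four_le_rkN_erase_erase_of_kColoops_eq_one hG hk hyG hyc
  exact localShadowHall_caseA_of_six_columns_noColoop hG hd hsimple hk hyG hyc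
    (fun S hS h6 hf hno => sum_r14W_col_le_of_card_six_of_noColoop' hG hd hsimple hyG hyc hP hS h6 hf hno)

section SixFour

variable {α' : Type} [DecidableEq α']

/-- **THE `(6, 4)` SHADOW ROW FOR EVERY FINITE MATROID**: `ShadowHall M 6 4 (phiK 6 4)`. -/
theorem shadowHall_six_four (M : Matroid α') [M.Finite] : ShadowHall M 6 4 (phiK 6 4) :=
  shadowHall_six_four_of_local_caseA
    (fun _ _ hs _ _ _ hG hd hk _ hyG hyc _ => localShadowHall_caseA hG hd hs hk hyG hyc) M

/-- **THE BODY OF C-025 AT `(6, 4)` FOR EVERY FINITE MATROID**: `Φ(6,4) · #{A : ρ(A) = 6, ρ(E ∖ A) = 4} ≤ #{A : 4 < ρ(A) < 6}`. -/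
theorem c025_six_four (M : Matroid α') [M.Finite] :
    phiK 6 4 * ({A : Set α' | A ⊆ M.E ∧ M.eRk A = ((6 : ℕ) : ℕ∞) ∧ M.eRk (M.E \ A) = ((4 : ℕ) : ℕ∞)}.ncard : ℚ) ≤
      ({A : Set α' | A ⊆ M.E ∧ ((4 : ℕ) : ℕ∞) < M.eRk A ∧ M.eRk A < ((6 : ℕ) : ℕ∞)}.ncard : ℚ) :=
  c025_of_shadowHall (shadowHall_six_four M)

end SixFour

end PercRepro.Shadow
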